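import Summits.CriticalPhenomena.PercolationContinuityZ3.Theorems.PercNearOneGluingNoHeavyLowerTailSahiCombMixFourSingleTwo
import Summits.CriticalPhenomena.PercolationContinuityZ3.Theorems.PercNearOneGluingNoHeavyLowerTailSahiCombMixFourSingleThree
import Summits.CriticalPhenomena.PercolationContinuityZ3.Theorems.PercNearOneGluingNoHeavyLowerTailSahiCombMixFourSingleFour

/-!
# The comb (tensor-Bernstein) hierarchy for Sahi's `E_k`, XLIII: comb H-MIX(4) — the interface `CombFourSingletonCells` DISCHARGED

Support file of the one-cut programme (crux `NoHeavyLowerTail`, stmt-CriticalPhenomena-4575; cell `prim-masterthm`, seat P3, gen 8; HIERARCHY.md §15(d),(i)).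
The sixteen singleton four-slot cells `E_4(μ_p; U_j ∪ [G j]{e∈ω})` of `SahiCombMix.CombFourSingletonCells` (`…SahiCombMixFour`) from the four classes
`combPos_fourSlot_G1/G2/G3/G4` (`…FourSingleOne/Two/Three/Four`) by transport along permutations of the events (`CombHereditary.reindex`, `sahiE_comp_perm`), and the
row `E_4(U)` itself for `G = 0`.
* `combPos_fourSingleton_transport`; **`combFourSingletonCells : CombFourSingletonCells`**. [this work]
-/

noncomputable section

open scoped Classical

namespace Summit.CriticalPhenomena.PercolationContinuityZ3.Theorems

open Finset Function
open Literature.Combinatorics.Sahi2008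
open Literature.Probability.Percolation.DecisionTree (ind ind_of_mem ind_of_not_mem ind_nonneg)
open SahiComb
open SahiCombDisjunct (orCoord)
open SahiCombHereditary (CombHereditary)

variable {ι : Type} [Fintype ι]

namespace SahiCombMix

/-- **Transport of a singleton four-slot cell along a permutation of the events.** [this work] -/
theorem combPos_fourSingleton_transport (U : Fin 4 → Set (Set ι)) (e : ι) (G G' : Fin 4 → Bool) (π : Equiv.Perm (Fin 4)) (hG : ∀ j, G' j = G (π j))
    (h : CombPos (fun _ : ι => 4) (fun p => sahiE (bernoulliWeight p) 4 (fun j => ind (orCoord (U ∘ π) e G' j)))) :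
    CombPos (fun _ : ι => 4) (fun p => sahiE (bernoulliWeight p) 4 (fun j => ind (orCoord U e G j))) := by
  have eF : (fun j => ind (orCoord (U ∘ π) e G' j)) = fun j => (fun i => ind (orCoord U e G i)) (π j) := by
    funext j
    unfold SahiCombDisjunct.orCoord
    rw [hG j]
    rfl
  refine h.congr fun p => ?_
  rw [eF, sahiE_comp_perm (bernoulliWeight p) 4 π (fun i => ind (orCoord U e G i))]

/-- **`CombFourSingletonCells` holds**: all sixteen singleton four-slot cells are comb-positive at multidegree `4`. [this work] -/
theorem combFourSingletonCells : CombFourSingletonCells := by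
  intro ι _ U e hUup hUe hU G
  have hG : G = ![G 0, G 1, G 2, G 3] := by funext i; fin_cases i <;> rfl
  rw [hG]
  cases G 0 <;> cases G 1 <;> cases G 2 <;> cases G 3
  · -- G = 0: the row E_4(U) itself
    have eU : (fun j => ind (orCoord U e (![false, false, false, false] : Fin 4 → Bool) j))
        = fun j => ind (⋂ i ∈ (![({0} : Finset (Fin 4)), {1}, {2}, {3}] : Fin 4 → Finset (Fin 4)) j, U i) := by
      funext j; fin_cases j <;> simp [SahiCombDisjunct.orCoord]
    rw [eU]; exact hU 4 _
  · exact combPos_fourSingleton_transport U e _ ![true, false, false, false] (Equiv.swap (0 : Fin 4) 3) (by decide)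
      (combPos_fourSlot_G1 (U ∘ (Equiv.swap (0 : Fin 4) 3)) e (fun j b => hUe _ b) (hU.reindex (Equiv.swap (0 : Fin 4) 3)))
  · exact combPos_fourSingleton_transport U e _ ![true, false, false, false] (Equiv.swap (0 : Fin 4) 2) (by decide)
      (combPos_fourSlot_G1 (U ∘ (Equiv.swap (0 : Fin 4) 2)) e (fun j b => hUe _ b) (hU.reindex (Equiv.swap (0 : Fin 4) 2)))
  · exact combPos_fourSingleton_transport U e _ ![true, true, false, false] ((Equiv.swap (0 : Fin 4) 2).trans (Equiv.swap (1 : Fin 4) 3)) (by decide)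
      (combPos_fourSlot_G2 (U ∘ ((Equiv.swap (0 : Fin 4) 2).trans (Equiv.swap (1 : Fin 4) 3))) e (fun j b => hUe _ b) (hU.reindex ((Equiv.swap (0 : Fin 4) 2).trans (Equiv.swap (1 : Fin 4) 3))))
  · exact combPos_fourSingleton_transport U e _ ![true, false, false, false] (Equiv.swap (0 : Fin 4) 1) (by decide)
      (combPos_fourSlot_G1 (U ∘ (Equiv.swap (0 : Fin 4) 1)) e (fun j b => hUe _ b) (hU.reindex (Equiv.swap (0 : Fin 4) 1)))
  · exact combPos_fourSingleton_transport U e _ ![true, true, false, false] (Equiv.swap (0 : Fin 4) 3) (by decide)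
      (combPos_fourSlot_G2 (U ∘ (Equiv.swap (0 : Fin 4) 3)) e (fun j b => hUe _ b) (hU.reindex (Equiv.swap (0 : Fin 4) 3)))
  · exact combPos_fourSingleton_transport U e _ ![true, true, false, false] (Equiv.swap (0 : Fin 4) 2) (by decide)
      (combPos_fourSlot_G2 (U ∘ (Equiv.swap (0 : Fin 4) 2)) e (fun j b => hUe _ b) (hU.reindex (Equiv.swap (0 : Fin 4) 2)))
  · exact combPos_fourSingleton_transport U e _ ![true, true, true, false] (Equiv.swap (0 : Fin 4) 3) (by decide)
      (combPos_fourSlot_G3 (U ∘ (Equiv.swap (0 : Fin 4) 3)) e (fun j b => hUe _ b) (hU.reindex (Equiv.swap (0 : Fin 4) 3)))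
  · exact combPos_fourSingleton_transport U e _ ![true, false, false, false] (Equiv.refl (Fin 4)) (by decide)
      (combPos_fourSlot_G1 (U ∘ (Equiv.refl (Fin 4))) e (fun j b => hUe _ b) (hU.reindex (Equiv.refl (Fin 4))))
  · exact combPos_fourSingleton_transport U e _ ![true, true, false, false] (Equiv.swap (1 : Fin 4) 3) (by decide)
      (combPos_fourSlot_G2 (U ∘ (Equiv.swap (1 : Fin 4) 3)) e (fun j b => hUe _ b) (hU.reindex (Equiv.swap (1 : Fin 4) 3)))
  · exact combPos_fourSingleton_transport U e _ ![true, true, false, false] (Equiv.swap (1 : Fin 4) 2) (by decide)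
      (combPos_fourSlot_G2 (U ∘ (Equiv.swap (1 : Fin 4) 2)) e (fun j b => hUe _ b) (hU.reindex (Equiv.swap (1 : Fin 4) 2)))
  · exact combPos_fourSingleton_transport U e _ ![true, true, true, false] (Equiv.swap (1 : Fin 4) 3) (by decide)
      (combPos_fourSlot_G3 (U ∘ (Equiv.swap (1 : Fin 4) 3)) e (fun j b => hUe _ b) (hU.reindex (Equiv.swap (1 : Fin 4) 3)))
  · exact combPos_fourSingleton_transport U e _ ![true, true, false, false] (Equiv.refl (Fin 4)) (by decide)
      (combPos_fourSlot_G2 (U ∘ (Equiv.refl (Fin 4))) e (fun j b => hUe _ b) (hU.reindex (Equiv.refl (Fin 4))))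
  · exact combPos_fourSingleton_transport U e _ ![true, true, true, false] (Equiv.swap (2 : Fin 4) 3) (by decide)
      (combPos_fourSlot_G3 (U ∘ (Equiv.swap (2 : Fin 4) 3)) e (fun j b => hUe _ b) (hU.reindex (Equiv.swap (2 : Fin 4) 3)))
  · exact combPos_fourSingleton_transport U e _ ![true, true, true, false] (Equiv.refl (Fin 4)) (by decide)
      (combPos_fourSlot_G3 (U ∘ (Equiv.refl (Fin 4))) e (fun j b => hUe _ b) (hU.reindex (Equiv.refl (Fin 4))))
  · exact combPos_fourSingleton_transport U e _ ![true, true, true, true] (Equiv.refl (Fin 4)) (by decide)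
      (combPos_fourSlot_G4 (U ∘ (Equiv.refl (Fin 4))) e (fun j b => hUe _ b) (hU.reindex (Equiv.refl (Fin 4))))

end SahiCombMix

end Summit.CriticalPhenomena.PercolationContinuityZ3.Theorems

end
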